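import Summits.AtomisticToContinuum.HydrodynamicLimit.Theorems.TwoClocksEquilibriumShearWindowLDFlowIndependence
import Summits.AtomisticToContinuum.HydrodynamicLimit.Theorems.TwoClocksEquilibriumShearWindowLDNormalForms
import Summits.AtomisticToContinuum.HydrodynamicLimit.Theorems.TwoClocksEquilibriumShearWindowLDThermal

/-!
# `EquilibriumShearWindowLD`: the combined normal form — parameters `(σ, φ)` only
# (route TwoClocks, stmt-AtomisticToContinuum-14446)

Helper file (`--supports` stmt-AtomisticToContinuum-14446), assembling the normal forms of the item
`TwoClocks.EquilibriumShearWindowLD` landed so far: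

* unit activity and one positive tilt per test function (`equilibriumShearWindowLD_iff_single_tilt`,
  convexity in the tilt, seat c2);
* unit temperature (`equilibriumShearWindowLD_iff_unit_temperature`, time–velocity scaling);
* any one fixed flow family (`shearWindowMoment_eq_of_flows`, forward uniqueness of hard-sphere flows).

`equilibriumShearWindowLD_iff_normalForm Φ₀`: for ANY choice of flow families `Φ₀ σ` (e.g. Alexander's
construction), the item is equivalent to

`∃ σ₀ > 0 ∀ σ ∈ (0, σ₀) ∀ φ ∈ C(𝕋³) ∃ β > 0 ∀ ε > 0 ∃ τ > 0 ∃ N₀ ∀ N ≥ N₀,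
  ∫ exp(β Σᵢ w⁻¹∫₀ʷ φ(xᵢ(r)) vᵢ⁰(r) vᵢ¹(r) dr) dG_N(1, 0, 1)[Φ₀ σ N] ≤ exp(ε(N+1))`, `w = τ(N+1)^{-1/3}`:

reduced diameter and test function are the only parameters left; activity, temperature, the interval of
tilts and the flow quantifier are decorative. Nothing dynamical is proved; the item (the `u₀ = 0`,
`F = φ v⁰v¹` instance of the open crux `EquilibriumFastWindowLD`, stmt-14440) stays open.

prover-pitem-stmt-AtomisticToContinuum-14446-c4-0.
-/

noncomputable section

open MeasureTheory Real Set
open scoped ENNReal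

namespace Summit.AtomisticToContinuum.HydrodynamicLimit.Theorems

open Literature.Analysis.FluidPDE Literature.MathematicalPhysics.KineticTheory
open Summit.AtomisticToContinuum.HydrodynamicLimit.Theses.TwoClocks

/-- **Combined normal form of `EquilibriumShearWindowLD`** (stmt-AtomisticToContinuum-14446): along any
fixed choice of flow families `Φ₀ σ`, the item is equivalent to
`∃ σ₀ > 0 ∀ σ ∈ (0, σ₀) ∀ φ continuous ∃ β > 0 ∀ ε > 0 ∃ τ > 0 ∃ N₀ ∀ N ≥ N₀,
M_N^{(1,1)}(β, τ; φ)[Φ₀ σ N] ≤ exp(ε(N+1))` (unit activity, unit temperature, ONE positive tilt per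
test function, ONE flow family). (`→`: specialise. `←`: shrink `σ₀` below `1/2` (probability
measures); given `θ₀, a₀, Φ, φ`, pass to unit temperature/activity
(`equilibriumShearWindowLD_iff_unit_temperature`), move the moment to `Φ₀ σ`
(`shearWindowMoment_eq_of_flows`), and fill the interval of tilts from the tilts of `φ` and `-φ` by
Lyapunov's inequality (`lintegral_exp_mul_le_of_le`, `shearWindowSum_neg`).) [folklore] -/
theorem equilibriumShearWindowLD_iff_normalForm
    (Φ₀ : (σ : ℝ) → (N : ℕ) → HardSphereFlow (Torus.geometry (Fin 3)) (hsDiameter σ N) (N + 1)) :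
    EquilibriumShearWindowLD ↔
      ∃ σ₀ : ℝ, 0 < σ₀ ∧ ∀ σ : ℝ, 0 < σ → σ < σ₀ → ∀ φ : T3 → ℝ, Continuous φ →
        ∃ β : ℝ, 0 < β ∧ ∀ ε : ℝ, 0 < ε → ∃ τ : ℝ, 0 < τ ∧ ∃ N₀ : ℕ, ∀ N : ℕ, N₀ ≤ N →
          ∫⁻ z, ENNReal.ofReal (Real.exp (β * ∑ i : Fin (N + 1),
              (τ * ((N : ℝ) + 1) ^ (-(1 / 3 : ℝ)))⁻¹ *
                ∫ r in (0 : ℝ)..(τ * ((N : ℝ) + 1) ^ (-(1 / 3 : ℝ))),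
                  φ ((Φ₀ σ N).flow r z i).1 *
                    (((Φ₀ σ N).flow r z i).2 0 * ((Φ₀ σ N).flow r z i).2 1)))
              ∂(localGibbsLaw σ (fun _ => (1 : ℝ)) (fun _ => 0) (fun _ => (1 : ℝ)) N (Φ₀ σ N)) ≤
            ENNReal.ofReal (Real.exp (ε * ((N : ℝ) + 1))) := by
  rw [equilibriumShearWindowLD_iff_unit_temperature]
  constructor
  · rintro ⟨σ₀, hσ₀, h⟩
    refine ⟨σ₀, hσ₀, fun σ hσ hσσ φ hφ => ?_⟩
    obtain ⟨β₀, hβ₀, hβ⟩ := h σ hσ hσσ (Φ₀ σ) φ hφ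
    exact ⟨β₀, hβ₀, hβ β₀ (by rw [abs_of_pos hβ₀])⟩
  · rintro ⟨σ₀, hσ₀, h⟩
    refine ⟨min σ₀ (1 / 2), lt_min hσ₀ (by norm_num), fun σ hσ hσσ Φ φ hφ => ?_⟩
    have hσσ₀ : σ < σ₀ := hσσ.trans_le (min_le_left _ _)
    have hσ2 : σ ≤ 1 / 2 := (hσσ.trans_le (min_le_right _ _)).le
    have hφn : Continuous fun x => -φ x := hφ.neg
    obtain ⟨βp, hβp, hp⟩ := h σ hσ hσσ₀ φ hφ
    obtain ⟨βm, hβm, hm⟩ := h σ hσ hσσ₀ (fun x => -φ x) hφn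
    refine ⟨min βp βm, lt_min hβp hβm, fun β hβ ε hε => ?_⟩
    haveI : ∀ N, IsProbabilityMeasure
        (localGibbsLaw σ (fun _ => (1 : ℝ)) (fun _ => 0) (fun _ => (1 : ℝ)) N (Φ N)) := fun N =>
      isProbabilityMeasure_localGibbsLaw (a₀ := fun _ => (1 : ℝ)) (θ₀ := fun _ => (1 : ℝ))
        (u₀ := fun _ => 0) continuous_const continuous_const continuous_const (fun _ => one_pos)
        (fun _ => one_pos) hσ2 N (Φ N)
    rcases le_or_gt 0 β with hβ0 | hβ0
    · -- `0 ≤ β ≤ βp`: Lyapunov from the tilt `βp` of `φ`, after moving the moment to `Φ`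
      obtain ⟨τ, hτ, N₀, hN⟩ := hp ε hε
      refine ⟨τ, hτ, N₀, fun N hNN => ?_⟩
      have hβle : β ≤ βp := ((abs_of_nonneg hβ0).symm.le.trans hβ).trans (min_le_left _ _)
      have hB : 0 ≤ ε * ((N : ℝ) + 1) := by positivity
      have hN' := hN N hNN
      rw [← shearWindowMoment_eq_of_flows 1 1 (Φ N) (Φ₀ σ N) φ βp hτ.le] at hN'
      exact lintegral_exp_mul_le_of_le (aemeasurable_shearWindowSum σ 1 1 N (Φ N) hφ _) hβp hβ0
        hβle hB hN'
    · -- `-βm ≤ β < 0`: the tilt `-β` of `-φ`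
      obtain ⟨τ, hτ, N₀, hN⟩ := hm ε hε
      refine ⟨τ, hτ, N₀, fun N hNN => ?_⟩
      have hβle : -β ≤ βm := ((abs_of_neg hβ0).symm.le.trans hβ).trans (min_le_right _ _)
      have hB : 0 ≤ ε * ((N : ℝ) + 1) := by positivity
      have hN' := hN N hNN
      rw [← shearWindowMoment_eq_of_flows 1 1 (Φ N) (Φ₀ σ N) (fun x => -φ x) βm hτ.le] at hN'
      have key := lintegral_exp_mul_le_of_le
        (aemeasurable_shearWindowSum σ 1 1 N (Φ N) hφn _) hβm (neg_pos.2 hβ0).le hβle hB hN'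
      refine le_of_eq_of_le (lintegral_congr fun z => ?_) key
      rw [shearWindowSum_neg, mul_neg, neg_mul, neg_neg]

end Summit.AtomisticToContinuum.HydrodynamicLimit.Theorems

end
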